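import Summits.CriticalPhenomena.PercolationContinuityZ3.Theorems.PercNearOneGluingNoHeavyLowerTailThreePointProductFormModuleTemplates

/-!
# The box theorem in DEFECT FORM: Perron cancellation made explicit in the physical pair identity
# (Sahi programme, one-child boundary-star cycle, prover prim-sahi-p2 gen 70)

Support file (`--supports stmt-CriticalPhenomena-4575`).  Standard axioms, no sorries, no named facts.  Memo
`run/shared/lean/prim/prim-sahi/FROM-prim-sahi-p2-gen70-MODULE-CP.md` §1, `prim-sahi-p2/PROOF-E3.md` §80.

THE OBJECT.  `boxval_append_cone` (gen 67, `…BoxPair`) writes the AM form of a concatenated physical word as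
`A[u++w] = (9/64)tt′ + (135/112)(tG′+Gt′) + (45/8)(tG_ψ′+G_ψt′) + 12000[β𝕄(m₊,m₋′) + β𝕄(m₋,m₊′)] + 300β𝕄(m³,m³′) − 12εε′` with the two
`a`-part column combinations `m₊ = colP = (4·col1 + 3·col2)/32` (in `−K ⊂ −L` along every physical word: `colP_negK`, `cols_negL`) and
`m₋ = colM = (4·col1 − 5·col2)/32` (the HUB-DEFECT column: it vanishes identically along pure hub words and carries no cone law).  Since
`m₊ = col1/5 − (3/5)·m₋` (`colP_eq_defect`), the middle term is `2400[β𝕄(col1, m₋′) + β𝕄(m₋, col1′)] − 14400·β𝕄(m₋, m₋′)`: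

* ★ `boxval_append_defect` — `A[u++w] = (9/64)tt′ + (135/112)(tG′+Gt′) + (45/8)(tG_ψ′+G_ψt′) + 2400[β𝕄(col1,m₋′) + β𝕄(m₋,col1′)]
  − 14400·β𝕄(m₋,m₋′) + 300·β𝕄(col3,col3′) − 12εε′`.  The coefficient of `β𝕄(col1, col1′)` is EXACTLY ZERO (Perron cancellation,
  `375 − 150 − 225 = 0`): the box theorem for long words ("LEMMA Q") is the statement that the term LINEAR in the defect column `m₋`, paired with
  the big signed column `col1 ∈ −L` of the other half, dominates the quadratic debts `14400β𝕄(m₋,m₋′)`, `300β𝕄(col3,col3′)` (signed) and `12εε′`.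
* `boxval_append_defect_iota` — the same identity with the column pairings written through the completely positive structure of THEOREM N′
  (`…ModuleCP`): `β𝕄(u,v) = (19/3136)pp′ + (29/392)(pq′+qp′) + (3/49)qq′ + (1/9)rr′` in the entries of `ι(u), ι(v)` (`betaM_iota`).
[this work] (gen 70).
-/

namespace Summit.CriticalPhenomena.PercolationContinuityZ3.Theorems.ProductFormModuleCP

open ProductFormCorners (V3)
open ProductFormABPlus
open ProductFormModuleCone

/-- `m₊ = col1/5 − (3/5)·m₋` (equivalently `col2 = (4·col1 − 32·m₋)/5`). [this work] -/
theorem colP_eq_defect (v : StA) :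
    colP v = ⟨(col1 v).x / 5 - (3/5) * (colM v).x, (col1 v).y / 5 - (3/5) * (colM v).y, (col1 v).z / 5 - (3/5) * (colM v).z⟩ := by
  ext <;> simp [colP, colM, col1] <;> ring

/-- Perron cancellation: `12000[β𝕄(m₊,m₋′) + β𝕄(m₋,m₊′)] = 2400[β𝕄(col1,m₋′) + β𝕄(m₋,col1′)] − 14400·β𝕄(m₋,m₋′)`. [this work] -/
theorem copy_pairing_defect (v w : StA) :
    12000 * (betaM (colP v) (colM w) + betaM (colM v) (colP w))
      = 2400 * (betaM (col1 v) (colM w) + betaM (colM v) (col1 w)) - 14400 * betaM (colM v) (colM w) := by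
  simp only [betaM, colP, colM, col1]; ring

/-- ★ THE PAIR IDENTITY IN DEFECT FORM.  For all words `u, w` (with `v = state(reverse u)`, `v′ = state(w)`):
`A[u++w] = (9/64)tt′ + (135/112)(tG′+Gt′) + (45/8)(tG_ψ′+G_ψt′) + 2400[β𝕄(col1,m₋′) + β𝕄(m₋,col1′)] − 14400β𝕄(m₋,m₋′) + 300β𝕄(col3,col3′) − 12εε′`.
[this work] -/
theorem boxval_append_defect (u w : List (ℚ × ℚ)) :
    boxval (u ++ w) =
      (9/64) * (brunA u.reverse omegaA).t * (brunA w omegaA).t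
      + (135/112) * ((brunA u.reverse omegaA).t * (zOf (brunA w omegaA)).G
          + (zOf (brunA u.reverse omegaA)).G * (brunA w omegaA).t)
      + (45/8) * ((brunA u.reverse omegaA).t * Gpsi (brunA w omegaA) + Gpsi (brunA u.reverse omegaA) * (brunA w omegaA).t)
      + 2400 * (betaM (col1 (brunA u.reverse omegaA)) (colM (brunA w omegaA))
          + betaM (colM (brunA u.reverse omegaA)) (col1 (brunA w omegaA)))
      - 14400 * betaM (colM (brunA u.reverse omegaA)) (colM (brunA w omegaA))
      + (300 * betaM (col3 (brunB u.reverse omegaB)) (col3 (brunB w omegaB))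
          - 12 * (brunB u.reverse omegaB).E4 * (brunB w omegaB).E4) := by
  rw [boxval_append_cone, copy_pairing_defect]
  ring

/-- The same identity with every `β𝕄` written through `ι` (THEOREM N′): `β𝕄(u,v) = (19/3136)pp′ + (29/392)(pq′+qp′) + (3/49)qq′ + (1/9)rr′`. [this work] -/
theorem boxval_append_defect_iota (u w : List (ℚ × ℚ)) :
    boxval (u ++ w) =
      (9/64) * (brunA u.reverse omegaA).t * (brunA w omegaA).t
      + (135/112) * ((brunA u.reverse omegaA).t * (zOf (brunA w omegaA)).G
          + (zOf (brunA u.reverse omegaA)).G * (brunA w omegaA).t)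
      + (45/8) * ((brunA u.reverse omegaA).t * Gpsi (brunA w omegaA) + Gpsi (brunA u.reverse omegaA) * (brunA w omegaA).t)
      + 2400 * (((19/3136) * (i11 (col1 (brunA u.reverse omegaA)) * i11 (colM (brunA w omegaA)))
                  + (29/392) * (i11 (col1 (brunA u.reverse omegaA)) * i22 (colM (brunA w omegaA))
                      + i22 (col1 (brunA u.reverse omegaA)) * i11 (colM (brunA w omegaA)))
                  + (3/49) * (i22 (col1 (brunA u.reverse omegaA)) * i22 (colM (brunA w omegaA)))
                  + (1/9) * (i12 (col1 (brunA u.reverse omegaA)) * i12 (colM (brunA w omegaA))))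
               + ((19/3136) * (i11 (colM (brunA u.reverse omegaA)) * i11 (col1 (brunA w omegaA)))
                  + (29/392) * (i11 (colM (brunA u.reverse omegaA)) * i22 (col1 (brunA w omegaA))
                      + i22 (colM (brunA u.reverse omegaA)) * i11 (col1 (brunA w omegaA)))
                  + (3/49) * (i22 (colM (brunA u.reverse omegaA)) * i22 (col1 (brunA w omegaA)))
                  + (1/9) * (i12 (colM (brunA u.reverse omegaA)) * i12 (col1 (brunA w omegaA)))))
      - 14400 * ((19/3136) * (i11 (colM (brunA u.reverse omegaA)) * i11 (colM (brunA w omegaA)))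
                  + (29/392) * (i11 (colM (brunA u.reverse omegaA)) * i22 (colM (brunA w omegaA))
                      + i22 (colM (brunA u.reverse omegaA)) * i11 (colM (brunA w omegaA)))
                  + (3/49) * (i22 (colM (brunA u.reverse omegaA)) * i22 (colM (brunA w omegaA)))
                  + (1/9) * (i12 (colM (brunA u.reverse omegaA)) * i12 (colM (brunA w omegaA))))
      + (300 * ((19/3136) * (i11 (col3 (brunB u.reverse omegaB)) * i11 (col3 (brunB w omegaB)))
                  + (29/392) * (i11 (col3 (brunB u.reverse omegaB)) * i22 (col3 (brunB w omegaB))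
                      + i22 (col3 (brunB u.reverse omegaB)) * i11 (col3 (brunB w omegaB)))
                  + (3/49) * (i22 (col3 (brunB u.reverse omegaB)) * i22 (col3 (brunB w omegaB)))
                  + (1/9) * (i12 (col3 (brunB u.reverse omegaB)) * i12 (col3 (brunB w omegaB))))
          - 12 * (brunB u.reverse omegaB).E4 * (brunB w omegaB).E4) := by
  rw [boxval_append_defect]
  simp only [betaM_iota]

end Summit.CriticalPhenomena.PercolationContinuityZ3.Theorems.ProductFormModuleCP
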